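import Summits.Ventures.GridStability.Models.InverterNetwork

/-!
# GridStability/Models/SwingFrequencyBound — global frequency boundedness of the classical swing model and the droop-microgrid frequency band (certificate-free, ALL initial states; contrast to the GFL divergence)

Cell `gridfusion` (LADDER-GRIDFUSION; seat gridfusion-model-3 (g7); models/MODEL-3-NOTES.md §1 (P14)
companion). The honest-framing partner of `Models/InverterPLLDivergence.lean`: there, the
grid-FOLLOWING reduced model (PLL generalized swing equation) has certified motions with
`ω → ±∞`; here, for the classical network-reduced model `M_cl` [cite: SauerPai1998, (7.215)–(7.216)]
— hence for every droop-controlled grid-FORMING microgrid at frozen voltages, which IS that model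
(`DroopMicrogrid.freqField_eq_field`, [cite: SchifferEtAl2014, Remark 3.3]) — EVERY motion has
ultimately bounded frequency deviations, with an explicit exponential bound from ANY initial state.

WHAT IS CERTIFIED (kernel, no certificate, every `n`). For machine/unit `i` with `M_i > 0`, `D_i > 0`
put `K_i := |P_i − E_i² G_ii| + Σ_{j ≠ i} (|C_ij| + |D_ij|)` (`imbalanceBound`; `|P_i − P_ei(δ)| ≤ K_i`
at EVERY angle configuration, `abs_P_sub_Pe_le`). Along every solution on `[0, ∞)`:
`ω_i(t) − K_i/D_i ≤ (ω_i(0) − K_i/D_i) e^{−(D_i/M_i) t}` and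
`ω_i(t) + K_i/D_i ≥ (ω_i(0) + K_i/D_i) e^{−(D_i/M_i) t}` (`speed_sub_le`, `le_speed_add`; Grönwall on
`(ω_i ∓ K_i/D_i) e^{(D_i/M_i)t}`), hence `|ω_i(t)| ≤ K_i/D_i + |ω_i(0)| e^{−(D_i/M_i) t}` (`abs_speed_le`)
and the slab `|ω_i| ≤ K_i/D_i` is positively invariant (`abs_speed_le_of_le`). §2 reads it on the
droop microgrid [cite: KunduEtAl2019, (4a)–(4b)] at frozen voltages: `D_i/M_i = 1/τ_Pi` and
`K_i/D_i = λ^p_i K_i`, i.e. **every unit's frequency deviation enters and stays in the droop band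
`|ω_i| ≤ λ^p_i K_i` at the power-filter rate `1/τ_Pi`, from any initial state**
(`DroopMicrogrid.abs_freq_le`) — the steady-state droop characteristic as a GLOBAL transient bound.

THREE COLUMNS. CERTIFIED: the inequalities (std axioms). MODELLED: classical model / droop microgrid
with FROZEN voltage magnitudes (MV-6N; the voltage loop (4c) is dropped), no limiter, no governor;
nothing here says a grid or a converter is stable — pole slipping (unbounded ANGLES) is fully compatible
with these bounds; only the SPEED deviations are bounded. VALIDATED: nothing. The contrast sentence
for memo §3: grid-forming droop units ≡ machines have a certified global frequency band; the
grid-following PLL model has certified divergence half-planes (p522699).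
-/

noncomputable section

open Real Set Filter Topology Finset

namespace Summit.Ventures.GridStability.Models

namespace ClassicalSwing

variable {n : ℕ} (p : ClassicalSwing n)

/-! ## §1 Classical model: power-imbalance bound and the speed funnel -/

/-- A state-independent bound on the power imbalance of machine `i`:
`K_i = |P_i − E_i² G_ii| + Σ_{j ≠ i} (|C_ij| + |D_ij|)` [cite: SauerPai1998, (7.212)–(7.214)]. -/
def imbalanceBound (i : Fin n) : ℝ :=
  |p.P i - p.E i ^ 2 * p.G i i| + ∑ j ∈ univ.erase i, (|p.Ccoef i j| + |p.Dcoef i j|)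

/-- `K_i ≥ 0`. -/
theorem imbalanceBound_nonneg (i : Fin n) : 0 ≤ p.imbalanceBound i := by
  unfold imbalanceBound
  positivity

/-- `|P_i − P_ei(δ)| ≤ K_i` at EVERY angle configuration (`|sin|, |cos| ≤ 1`). -/
theorem abs_P_sub_Pe_le (δ : Fin n → ℝ) (i : Fin n) : |p.P i - p.Pe δ i| ≤ p.imbalanceBound i := by
  unfold Pe imbalanceBound
  have hsum : |∑ j ∈ univ.erase i, (p.Ccoef i j * sin (δ i - δ j) + p.Dcoef i j * cos (δ i - δ j))|
      ≤ ∑ j ∈ univ.erase i, (|p.Ccoef i j| + |p.Dcoef i j|) := by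
    refine (abs_sum_le_sum_abs _ _).trans (sum_le_sum fun j _ => ?_)
    have h1 : |p.Ccoef i j * sin (δ i - δ j)| ≤ |p.Ccoef i j| := by
      rw [abs_mul]
      exact mul_le_of_le_one_right (abs_nonneg _) (abs_sin_le_one _)
    have h2 : |p.Dcoef i j * cos (δ i - δ j)| ≤ |p.Dcoef i j| := by
      rw [abs_mul]
      exact mul_le_of_le_one_right (abs_nonneg _) (abs_cos_le_one _)
    exact (abs_add_le _ _).trans (add_le_add h1 h2)
  have hsplit : p.P i - (p.E i ^ 2 * p.G i i +
        ∑ j ∈ univ.erase i, (p.Ccoef i j * sin (δ i - δ j) + p.Dcoef i j * cos (δ i - δ j)))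
      = (p.P i - p.E i ^ 2 * p.G i i)
        - ∑ j ∈ univ.erase i, (p.Ccoef i j * sin (δ i - δ j) + p.Dcoef i j * cos (δ i - δ j)) := by
    ring
  rw [hsplit]
  exact (abs_sub _ _).trans (add_le_add le_rfl hsum)

variable {p}

/-- The speed-deviation component `ω_i` of a solution is differentiable within the time set with
derivative `(P_i − P_ei(δ) − D_i ω_i)/M_i`. -/
theorem hasDerivWithinAt_speed {γ : ℝ → State n} {s : Set ℝ} (h : p.IsSolutionOn γ s) {t : ℝ}
    (ht : t ∈ s) (i : Fin n) :
    HasDerivWithinAt (fun τ => (γ τ).2 i)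
      ((p.P i - p.Pe (γ t).1 i - p.D i * (γ t).2 i) / p.M i) s t := by
  have h2 : HasDerivWithinAt (fun τ => (γ τ).2) ((p.field (γ t)).2) s t := by
    simpa using (h t ht).hasFDerivWithinAt.snd.hasDerivWithinAt
  have := (hasDerivWithinAt_pi.1 h2) i
  simpa [field] using this

/-- **Speed funnel, upper side.** For `M_i > 0`, `D_i > 0`, along every solution on `[0, ∞)`:
`ω_i(t) − K_i/D_i ≤ (ω_i(0) − K_i/D_i) · e^{−(D_i/M_i) t}` for all `t ≥ 0`. -/
theorem speed_sub_le {γ : ℝ → State n} (h : p.IsSolutionOn γ (Ici 0)) {i : Fin n}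
    (hM : 0 < p.M i) (hD : 0 < p.D i) {t : ℝ} (ht : 0 ≤ t) :
    (γ t).2 i - p.imbalanceBound i / p.D i
      ≤ ((γ 0).2 i - p.imbalanceBound i / p.D i) * exp (-(p.D i / p.M i) * t) := by
  set K := p.imbalanceBound i with hK
  set g : ℝ → ℝ := fun τ => ((γ τ).2 i - K / p.D i) * exp (p.D i / p.M i * τ) with hg
  have hderiv : ∀ τ ∈ Ici (0:ℝ), HasDerivWithinAt g
      ((p.P i - p.Pe (γ τ).1 i - K) / p.M i * exp (p.D i / p.M i * τ)) (Ici 0) τ := by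
    intro τ hτ
    have h1 := (hasDerivWithinAt_speed h hτ i).sub_const (K / p.D i)
    have h2 : HasDerivWithinAt (fun s => exp (p.D i / p.M i * s))
        (exp (p.D i / p.M i * τ) * (p.D i / p.M i * 1)) (Ici 0) τ :=
      (((hasDerivWithinAt_id τ _).const_mul (p.D i / p.M i)).exp)
    have h12 := h1.mul h2
    have he : (p.P i - p.Pe (γ τ).1 i - p.D i * (γ τ).2 i) / p.M i * exp (p.D i / p.M i * τ)
        + ((γ τ).2 i - K / p.D i) * (exp (p.D i / p.M i * τ) * (p.D i / p.M i * 1))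
        = (p.P i - p.Pe (γ τ).1 i - K) / p.M i * exp (p.D i / p.M i * τ) := by
      field_simp
      ring
    rw [he] at h12
    exact h12
  have hanti : AntitoneOn g (Ici 0) := by
    refine antitoneOn_of_hasDerivWithinAt_nonpos (convex_Ici 0)
      (f' := fun τ => (p.P i - p.Pe (γ τ).1 i - K) / p.M i * exp (p.D i / p.M i * τ))
      (fun τ hτ => (hderiv τ hτ).continuousWithinAt) (fun τ hτ => ?_) (fun τ hτ => ?_)
    · rw [interior_Ici] at hτ ⊢
      exact (hderiv τ (mem_Ici.2 (le_of_lt hτ))).mono Ioi_subset_Ici_self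
    · rw [interior_Ici] at hτ
      have hb := p.abs_P_sub_Pe_le (γ τ).1 i
      have hnum : p.P i - p.Pe (γ τ).1 i - K ≤ 0 := by
        have := (abs_le.mp hb).2; linarith
      have : (p.P i - p.Pe (γ τ).1 i - K) / p.M i ≤ 0 := div_nonpos_of_nonpos_of_nonneg hnum hM.le
      exact mul_nonpos_of_nonpos_of_nonneg this (exp_pos _).le
  have hg0 := hanti (mem_Ici.2 le_rfl) (mem_Ici.2 ht) ht
  simp only [hg, mul_zero, exp_zero, mul_one] at hg0
  -- (ω t − K/D) e^{(D/M)t} ≤ ω 0 − K/D ⇒ divide by the exponential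
  have hpos : 0 < exp (p.D i / p.M i * t) := exp_pos _
  have hexp : exp (-(p.D i / p.M i) * t) * exp (p.D i / p.M i * t) = 1 := by
    rw [← exp_add]; simp [neg_mul]
  have key : ((γ t).2 i - K / p.D i) * exp (p.D i / p.M i * t)
      ≤ ((γ 0).2 i - K / p.D i) * exp (-(p.D i / p.M i) * t) * exp (p.D i / p.M i * t) := by
    rw [mul_assoc, hexp, mul_one]; exact hg0
  exact le_of_mul_le_mul_right key hpos

/-- **Speed funnel, lower side.** For `M_i > 0`, `D_i > 0`, along every solution on `[0, ∞)`:
`(ω_i(0) + K_i/D_i) · e^{−(D_i/M_i) t} ≤ ω_i(t) + K_i/D_i` for all `t ≥ 0`. -/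
theorem le_speed_add {γ : ℝ → State n} (h : p.IsSolutionOn γ (Ici 0)) {i : Fin n}
    (hM : 0 < p.M i) (hD : 0 < p.D i) {t : ℝ} (ht : 0 ≤ t) :
    ((γ 0).2 i + p.imbalanceBound i / p.D i) * exp (-(p.D i / p.M i) * t)
      ≤ (γ t).2 i + p.imbalanceBound i / p.D i := by
  set K := p.imbalanceBound i with hK
  set g : ℝ → ℝ := fun τ => ((γ τ).2 i + K / p.D i) * exp (p.D i / p.M i * τ) with hg
  have hderiv : ∀ τ ∈ Ici (0:ℝ), HasDerivWithinAt g
      ((p.P i - p.Pe (γ τ).1 i + K) / p.M i * exp (p.D i / p.M i * τ)) (Ici 0) τ := by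
    intro τ hτ
    have h1 := (hasDerivWithinAt_speed h hτ i).add_const (K / p.D i)
    have h2 : HasDerivWithinAt (fun s => exp (p.D i / p.M i * s))
        (exp (p.D i / p.M i * τ) * (p.D i / p.M i * 1)) (Ici 0) τ :=
      (((hasDerivWithinAt_id τ _).const_mul (p.D i / p.M i)).exp)
    have h12 := h1.mul h2
    have he : (p.P i - p.Pe (γ τ).1 i - p.D i * (γ τ).2 i) / p.M i * exp (p.D i / p.M i * τ)
        + ((γ τ).2 i + K / p.D i) * (exp (p.D i / p.M i * τ) * (p.D i / p.M i * 1))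
        = (p.P i - p.Pe (γ τ).1 i + K) / p.M i * exp (p.D i / p.M i * τ) := by
      field_simp
      ring
    rw [he] at h12
    exact h12
  have hmono : MonotoneOn g (Ici 0) := by
    refine monotoneOn_of_hasDerivWithinAt_nonneg (convex_Ici 0)
      (f' := fun τ => (p.P i - p.Pe (γ τ).1 i + K) / p.M i * exp (p.D i / p.M i * τ))
      (fun τ hτ => (hderiv τ hτ).continuousWithinAt) (fun τ hτ => ?_) (fun τ hτ => ?_)
    · rw [interior_Ici] at hτ ⊢
      exact (hderiv τ (mem_Ici.2 (le_of_lt hτ))).mono Ioi_subset_Ici_self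
    · rw [interior_Ici] at hτ
      have hb := p.abs_P_sub_Pe_le (γ τ).1 i
      have hnum : 0 ≤ p.P i - p.Pe (γ τ).1 i + K := by
        have := (abs_le.mp hb).1; linarith
      have : 0 ≤ (p.P i - p.Pe (γ τ).1 i + K) / p.M i := div_nonneg hnum hM.le
      exact mul_nonneg this (exp_pos _).le
  have hg0 := hmono (mem_Ici.2 le_rfl) (mem_Ici.2 ht) ht
  simp only [hg, mul_zero, exp_zero, mul_one] at hg0
  have hpos : 0 < exp (p.D i / p.M i * t) := exp_pos _
  have hexp : exp (-(p.D i / p.M i) * t) * exp (p.D i / p.M i * t) = 1 := by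
    rw [← exp_add]; simp [neg_mul]
  have key : ((γ 0).2 i + K / p.D i) * exp (-(p.D i / p.M i) * t) * exp (p.D i / p.M i * t)
      ≤ ((γ t).2 i + K / p.D i) * exp (p.D i / p.M i * t) := by
    rw [mul_assoc, hexp, mul_one]; exact hg0
  exact le_of_mul_le_mul_right key hpos

/-- **Global speed bound (classical model, every `n`, every initial state).** For `M_i > 0`,
`D_i > 0`, along every solution of `M_cl` on `[0, ∞)`:
`|ω_i(t)| ≤ K_i/D_i + |ω_i(0)| · e^{−(D_i/M_i) t}` for all `t ≥ 0` — the speed deviation of every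
machine is ULTIMATELY BOUNDED by `K_i/D_i`, whatever the angles do (pole slipping included).
MODELLED: `M_cl` [cite: SauerPai1998, (7.215)–(7.216)], no governor, no limiter. -/
theorem abs_speed_le {γ : ℝ → State n} (h : p.IsSolutionOn γ (Ici 0)) {i : Fin n}
    (hM : 0 < p.M i) (hD : 0 < p.D i) {t : ℝ} (ht : 0 ≤ t) :
    |(γ t).2 i| ≤ p.imbalanceBound i / p.D i + |(γ 0).2 i| * exp (-(p.D i / p.M i) * t) := by
  have hup := speed_sub_le h hM hD ht
  have hlo := le_speed_add h hM hD ht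
  have hKD : 0 ≤ p.imbalanceBound i / p.D i := div_nonneg (p.imbalanceBound_nonneg i) hD.le
  have he : 0 < exp (-(p.D i / p.M i) * t) := exp_pos _
  have h0 := le_abs_self ((γ 0).2 i)
  have h0' := neg_abs_le ((γ 0).2 i)
  rw [abs_le]
  constructor
  · nlinarith
  · nlinarith

/-- **The speed slab is positively invariant.** If `|ω_i(0)| ≤ K_i/D_i` then `|ω_i(t)| ≤ K_i/D_i`
for all `t ≥ 0` (any `n`, any angles). -/
theorem abs_speed_le_of_le {γ : ℝ → State n} (h : p.IsSolutionOn γ (Ici 0)) {i : Fin n}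
    (hM : 0 < p.M i) (hD : 0 < p.D i) (h0 : |(γ 0).2 i| ≤ p.imbalanceBound i / p.D i)
    {t : ℝ} (ht : 0 ≤ t) : |(γ t).2 i| ≤ p.imbalanceBound i / p.D i := by
  have hup := speed_sub_le h hM hD ht
  have hlo := le_speed_add h hM hD ht
  have he : 0 < exp (-(p.D i / p.M i) * t) := exp_pos _
  have h0' := abs_le.mp h0
  rw [abs_le]
  constructor
  · nlinarith
  · nlinarith

/-- **Eventual bound.** For every `ε > 0` there is a time after which `|ω_i(t)| ≤ K_i/D_i + ε`
(explicitly: as soon as `|ω_i(0)| e^{−(D_i/M_i) t} ≤ ε`). -/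
theorem eventually_abs_speed_le {γ : ℝ → State n} (h : p.IsSolutionOn γ (Ici 0)) {i : Fin n}
    (hM : 0 < p.M i) (hD : 0 < p.D i) {ε : ℝ} (hε : 0 < ε) :
    ∀ᶠ t in atTop, |(γ t).2 i| ≤ p.imbalanceBound i / p.D i + ε := by
  have hdec : Tendsto (fun t : ℝ => |(γ 0).2 i| * exp (-(p.D i / p.M i) * t)) atTop (𝓝 0) := by
    have hc : 0 < p.D i / p.M i := div_pos hD hM
    have h1 : Tendsto (fun t : ℝ => -(p.D i / p.M i) * t) atTop atBot := by
      refine (tendsto_neg_atTop_atBot.comp (tendsto_id.const_mul_atTop hc)).congr fun t => ?_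
      simp [neg_mul]
    have h2 := tendsto_exp_atBot.comp h1
    simpa using h2.const_mul |(γ 0).2 i|
  have hev := (hdec.eventually (eventually_le_nhds hε))
  filter_upwards [hev, eventually_ge_atTop (0:ℝ)] with t ht ht0
  have := abs_speed_le h hM hD ht0
  have ht' : |(γ 0).2 i| * exp (-(p.D i / p.M i) * t) ≤ ε := by simpa using ht
  linarith

end ClassicalSwing

/-! ## §2 The droop microgrid at frozen voltages: the droop band as a global transient bound -/

namespace DroopMicrogrid

variable {n : ℕ} (mg : DroopMicrogrid n)

/-- **Droop frequency band, global in state.** For a droop-controlled microgrid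
[cite: KunduEtAl2019, (4a)–(4b)] with gains `λ^p_i > 0`, filter constants `τ_Pi > 0`, at FROZEN
voltage magnitudes `V` (the classical record `toClassicalSwing V`): along every solution on
`[0, ∞)` and for every unit `i`,
`|ω_i(t)| ≤ λ^p_i K_i + |ω_i(0)| · e^{−t/τ_Pi}`, `K_i = |P_i^set − V_i² G_ii| + Σ_{j≠i} V_iV_j(|B_ij| + |G_ij|)`
(`= (toClassicalSwing V).imbalanceBound i`): every unit's frequency deviation enters and stays in the
DROOP BAND `λ^p_i K_i` at the power-filter rate, from ANY initial state — the steady-state droop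
characteristic read as a certified global transient bound. MODELLED: MV-6N (frozen voltages, reduced
network), no limiter. Contrast: the grid-following PLL model diverges (`InverterPLLDivergence`). -/
theorem abs_freq_le (hk : ∀ i, 0 < mg.kP i) (hτ : ∀ i, 0 < mg.τP i) (V : Fin n → ℝ)
    {γ : ℝ → ClassicalSwing.State n} (h : (mg.toClassicalSwing V).IsSolutionOn γ (Ici 0))
    (i : Fin n) {t : ℝ} (ht : 0 ≤ t) :
    |(γ t).2 i| ≤ mg.kP i * (mg.toClassicalSwing V).imbalanceBound i
      + |(γ 0).2 i| * exp (-(t / mg.τP i)) := by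
  have hM : 0 < (mg.toClassicalSwing V).M i := by
    show 0 < mg.τP i / mg.kP i; exact div_pos (hτ i) (hk i)
  have hD : 0 < (mg.toClassicalSwing V).D i := by
    show 0 < 1 / mg.kP i; exact div_pos one_pos (hk i)
  have hb := ClassicalSwing.abs_speed_le h hM hD ht
  have hk0 := (hk i).ne'
  have hτ0 := (hτ i).ne'
  have e1 : (mg.toClassicalSwing V).imbalanceBound i / (mg.toClassicalSwing V).D i
      = mg.kP i * (mg.toClassicalSwing V).imbalanceBound i := by
    show _ / (1 / mg.kP i) = _
    field_simp
  have e2 : -((mg.toClassicalSwing V).D i / (mg.toClassicalSwing V).M i) * t = -(t / mg.τP i) := by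
    show -((1 / mg.kP i) / (mg.τP i / mg.kP i)) * t = _
    field_simp
  rw [e1, e2] at hb
  exact hb

/-- **Slab invariance for the droop microgrid.** If `|ω_i(0)| ≤ λ^p_i K_i` then
`|ω_i(t)| ≤ λ^p_i K_i` for all `t ≥ 0` (frozen voltages). -/
theorem abs_freq_le_of_le (hk : ∀ i, 0 < mg.kP i) (hτ : ∀ i, 0 < mg.τP i) (V : Fin n → ℝ)
    {γ : ℝ → ClassicalSwing.State n} (h : (mg.toClassicalSwing V).IsSolutionOn γ (Ici 0))
    (i : Fin n) (h0 : |(γ 0).2 i| ≤ mg.kP i * (mg.toClassicalSwing V).imbalanceBound i)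
    {t : ℝ} (ht : 0 ≤ t) : |(γ t).2 i| ≤ mg.kP i * (mg.toClassicalSwing V).imbalanceBound i := by
  have hM : 0 < (mg.toClassicalSwing V).M i := by
    show 0 < mg.τP i / mg.kP i; exact div_pos (hτ i) (hk i)
  have hD : 0 < (mg.toClassicalSwing V).D i := by
    show 0 < 1 / mg.kP i; exact div_pos one_pos (hk i)
  have e1 : (mg.toClassicalSwing V).imbalanceBound i / (mg.toClassicalSwing V).D i
      = mg.kP i * (mg.toClassicalSwing V).imbalanceBound i := by
    show _ / (1 / mg.kP i) = _
    have hk0 := (hk i).ne'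
    field_simp
  have := ClassicalSwing.abs_speed_le_of_le h hM hD (by rw [e1]; exact h0) ht
  rw [e1] at this
  exact this

end DroopMicrogrid

end Summit.Ventures.GridStability.Models

end
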